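import Summits.HubbardSuperconductivity.HubbardSuperconductivity.Theses.LogColdTorus
import Summits.HubbardSuperconductivity.HubbardSuperconductivity.Theorems.AbelianDualityThermalToGroundAverage
import Literature.MathematicalPhysics.QuantumLattice.GibbsStatePerturbationBound
import Literature.MathematicalPhysics.QuantumLattice.DWaveSourceProofs
import HarnessLib

/-!
# Route `LogColdTorus`, crux `AverageToEvery` (item `stmt-HubbardSuperconductivity-10519`): a vanishing
# conjugate penalty is invisible at the log-cold scale

Helper (`--supports`) for the crux
`Summit.HubbardSuperconductivity.HubbardSuperconductivity.Theses.LogColdTorus.AverageToEvery`,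
complementing `Theorems/LogColdTorusAverageToEveryRecut.lean` (the conjugate-source re-cut of this
route). In the route's own block format (`Matrix.gibbsState β` of the sector compression
`Matrix.toBlock p p`):

* `re_gibbsState_toBlock_penalised_ge` — switching on the d-wave pair penalty
  `ε · L⁻⁴ Δ_d† Δ_d` (`ε ≥ 0`) lowers the sector Gibbs expectation of `Δ_d† Δ_d` at inverse
  temperature `β ≥ 0` by at most `2 β ε C_d⁴ L⁴`, `C_d = 2 Σ_e |d(e)/√2|` the constant of
  `norm_pairField_le` (Gibbs expectations are `2β‖V‖‖O‖`-Lipschitz in the Hamiltonian,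
  `Matrix.abs_re_gibbsState_add_sub_re_gibbsState_le`; compression does not increase norms,
  `norm_toBlock_le`). Hence at `β = κ log L` a penalty `ε_L = o(1/log L)` costs `o(L⁴)`: log-cold
  `d`-wave order of `hubbardTorus 2 L 1 U` transfers for free to the vanishing-penalty family
  `hubbardTorus 2 L 1 U + ε_L L⁻⁴ Δ_d† Δ_d` (RECUT-c17 §2 item 4: the optional split of the merged
  descent crux).
* `logColdOrder_penalised_of_logColdOrder` — the packaged transfer at `β = κ log L` with the
  explicit admissible penalty `ε ≤ c / (4 κ C_d⁴ log L)`: order `c L⁴` for `H` gives order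
  `(c/2) L⁴` for the penalised block.

Bratteli–Robinson II (1997) Prop. 5.4.1; Scalapino, Phys. Rep. 250 (1995) 329 §2. Folklore
bookkeeping; no definition and no named fact is introduced.
-/

noncomputable section

-- `dupNamespace`: the summit and the problem are both named `HubbardSuperconductivity` (layout D-0022)
set_option linter.dupNamespace false

namespace Summit.HubbardSuperconductivity.HubbardSuperconductivity.Theorems

open Matrix Finset Filter
open Literature.Probability.LatticeModels Literature.MathematicalPhysics.QuantumLattice
open scoped ComplexOrder Matrix Classical Matrix.Norms.L2Operator

/-- **A conjugate pair penalty moves the sector Gibbs expectation of `Δ_d† Δ_d` by at most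
`2 β ε C_d⁴ L⁴`.** For every side `L ≥ 1`, coupling `U`, sector predicate `p`, `β ≥ 0` and `ε ≥ 0`:
`re ⟨(Δ_d†Δ_d)_p⟩_{β, (H + ε L⁻⁴ Δ_d†Δ_d)_p} ≥ re ⟨(Δ_d†Δ_d)_p⟩_{β, H_p} - 2 β ε C_d⁴ L⁴`, where `X_p`
is the compression `X.toBlock p p`, `H = hubbardTorus 2 L 1 U` and `C_d = 2 Σ_{e} |d(e)/√2|`
(`‖Δ_d‖ ≤ C_d L²`, `norm_pairField_le`). Lipschitz bound of Gibbs expectations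
(`Matrix.abs_re_gibbsState_add_sub_re_gibbsState_le`) with `‖(ε L⁻⁴ Δ_d†Δ_d)_p‖ ≤ ε C_d²` and
`‖(Δ_d†Δ_d)_p‖ ≤ C_d² L⁴` (`norm_toBlock_le`); on an empty block both states are the junk `0`.
Bratteli–Robinson II Prop. 5.4.1. [folklore] -/
theorem re_gibbsState_toBlock_penalised_ge (L : ℕ) [NeZero L] (U β ε : ℝ) (hβ : 0 ≤ β) (hε : 0 ≤ ε)
    (p : Finset (Orb (FermionTorus 2 L)) → Prop) :
    (Matrix.gibbsState β ((hubbardTorus 2 L 1 U).toBlock p p)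
        (((pairField dWaveFormFactor L)ᴴ * pairField dWaveFormFactor L).toBlock p p)).re -
      2 * β * ε * (2 * ∑ e ∈ insert (0 : Site 2) unitSteps, |dWaveFormFactor e / Real.sqrt 2|) ^ 4 *
        (L : ℝ) ^ 4 ≤
    (Matrix.gibbsState β ((hubbardTorus 2 L 1 U + (ε : ℂ) •
        (((1 : ℂ) / (L : ℂ) ^ 4) • ((pairField dWaveFormFactor L)ᴴ * pairField dWaveFormFactor L))).toBlock p p)
        (((pairField dWaveFormFactor L)ᴴ * pairField dWaveFormFactor L).toBlock p p)).re := by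
  set Cd : ℝ := 2 * ∑ e ∈ insert (0 : Site 2) unitSteps, |dWaveFormFactor e / Real.sqrt 2| with hCd
  set Y : Matrix (Finset (Orb (FermionTorus 2 L))) (Finset (Orb (FermionTorus 2 L))) ℂ :=
    (pairField dWaveFormFactor L)ᴴ * pairField dWaveFormFactor L with hYdef
  set H : Matrix (Finset (Orb (FermionTorus 2 L))) (Finset (Orb (FermionTorus 2 L))) ℂ :=
    hubbardTorus 2 L 1 U with hHdef
  set V : Matrix (Finset (Orb (FermionTorus 2 L))) (Finset (Orb (FermionTorus 2 L))) ℂ :=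
    (ε : ℂ) • (((1 : ℂ) / (L : ℂ) ^ 4) • Y) with hVdef
  have hL : (0 : ℝ) < (L : ℝ) := by exact_mod_cast Nat.pos_of_ne_zero (NeZero.ne L)
  have hL4 : (0 : ℝ) < (L : ℝ) ^ 4 := by positivity
  have hCd0 : 0 ≤ Cd := by
    rw [hCd]; exact mul_nonneg zero_le_two (Finset.sum_nonneg fun _ _ => abs_nonneg _)
  have herr0 : 0 ≤ 2 * β * ε * Cd ^ 4 * (L : ℝ) ^ 4 := by positivity
  by_cases hne : Nonempty {s // p s}
  · -- hermiticity of the blocks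
    have hHh : H.IsHermitian := LiebThm1.hamiltonian_isHermitian (fermionTorusGraph 2 L) 1 U
    have hYh : Y.IsHermitian := isHermitian_conjTranspose_mul_self _
    have hVh : V.IsHermitian := by
      rw [hVdef, smul_smul]
      refine hYh.smul ?_
      rw [isSelfAdjoint_iff, star_mul', Complex.star_def, Complex.conj_ofReal,
        map_div₀, map_one, map_pow, Complex.conj_natCast]
    have hHb : (H.toBlock p p).IsHermitian := hHh.submatrix _
    have hVb : (V.toBlock p p).IsHermitian := hVh.submatrix _
    have hadd : (H + V).toBlock p p = H.toBlock p p + V.toBlock p p := rfl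
    -- the Lipschitz bound
    have key := Matrix.abs_re_gibbsState_add_sub_re_gibbsState_le hHb hVb hβ (Y.toBlock p p)
    rw [← hadd] at key
    -- norms
    have hΔ : ‖pairField dWaveFormFactor L‖ ≤ Cd * (L : ℝ) ^ 2 := norm_pairField_le dWaveFormFactor L
    have hYn : ‖Y‖ ≤ (Cd * (L : ℝ) ^ 2) ^ 2 := by
      rw [hYdef]
      calc ‖(pairField dWaveFormFactor L)ᴴ * pairField dWaveFormFactor L‖
          ≤ ‖(pairField dWaveFormFactor L)ᴴ‖ * ‖pairField dWaveFormFactor L‖ := Matrix.l2_opNorm_mul _ _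
        _ = ‖pairField dWaveFormFactor L‖ * ‖pairField dWaveFormFactor L‖ := by
            rw [Matrix.l2_opNorm_conjTranspose]
        _ ≤ (Cd * (L : ℝ) ^ 2) * (Cd * (L : ℝ) ^ 2) :=
            mul_le_mul hΔ hΔ (norm_nonneg _) (by positivity)
        _ = (Cd * (L : ℝ) ^ 2) ^ 2 := by ring
    have hVn : ‖V.toBlock p p‖ ≤ ε * Cd ^ 2 := by
      calc ‖V.toBlock p p‖ ≤ ‖V‖ := norm_toBlock_le V p
        _ = ε * ((1 : ℝ) / (L : ℝ) ^ 4) * ‖Y‖ := by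
            rw [hVdef, norm_smul, norm_smul, Complex.norm_real, Real.norm_of_nonneg hε, norm_div,
              norm_one, norm_pow, Complex.norm_natCast, mul_assoc]
        _ ≤ ε * ((1 : ℝ) / (L : ℝ) ^ 4) * (Cd * (L : ℝ) ^ 2) ^ 2 :=
            mul_le_mul_of_nonneg_left hYn (by positivity)
        _ = ε * Cd ^ 2 := by field_simp
    have hYbn : ‖Y.toBlock p p‖ ≤ Cd ^ 2 * (L : ℝ) ^ 4 := by
      calc ‖Y.toBlock p p‖ ≤ ‖Y‖ := norm_toBlock_le Y p
        _ ≤ (Cd * (L : ℝ) ^ 2) ^ 2 := hYn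
        _ = Cd ^ 2 * (L : ℝ) ^ 4 := by ring
    have hprod : 2 * β * ‖V.toBlock p p‖ * ‖Y.toBlock p p‖ ≤ 2 * β * ε * Cd ^ 4 * (L : ℝ) ^ 4 := by
      calc 2 * β * ‖V.toBlock p p‖ * ‖Y.toBlock p p‖
          ≤ 2 * β * (ε * Cd ^ 2) * (Cd ^ 2 * (L : ℝ) ^ 4) := by
            apply mul_le_mul (mul_le_mul_of_nonneg_left hVn (by positivity)) hYbn (norm_nonneg _)
            positivity
        _ = 2 * β * ε * Cd ^ 4 * (L : ℝ) ^ 4 := by ring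
    have h := (abs_le.mp (key.trans hprod)).1
    linarith
  · -- empty block: both Gibbs states are the junk value `0`
    have hem : IsEmpty {s // p s} := not_nonempty_iff.mp hne
    have hzero : ∀ A O : Matrix {s // p s} {s // p s} ℂ, Matrix.gibbsState β A O = 0 := by
      intro A O
      rw [Matrix.gibbsState_apply, Matrix.trace]
      simp
    rw [hzero, hzero, Complex.zero_re]
    linarith

/-- **Log-cold order transfers to the vanishing-penalty family.** At `β = κ log L` (`κ ≥ 0`, `L ≥ 1`)
and with a penalty strength `0 ≤ ε ≤ c / (4 κ C_d⁴ log L)` (any `ε ≥ 0` when `κ log L = 0`), sector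
`d`-wave order `c L⁴ ≤ re ⟨Δ_d†Δ_d⟩` of `hubbardTorus 2 L 1 U` implies order `(c/2) L⁴` for the
penalised `hubbardTorus 2 L 1 U + ε L⁻⁴ Δ_d† Δ_d`, in the block format of `LogColdDWaveOrder`
(`re_gibbsState_toBlock_penalised_ge`). So the thermal hypothesis of the merged descent crux of
`Theorems/LogColdTorusAverageToEveryRecut.lean` may be stated for the penalised family with
`ε_L = c/(4κC_d⁴ log L)` at no cost to the engine. Bratteli–Robinson II Prop. 5.4.1. [folklore] -/
theorem logColdOrder_penalised_of_logColdOrder : ∀ (L : ℕ) [NeZero L] (U κ ε c : ℝ), 0 ≤ κ → 0 ≤ ε → ε * (κ * Real.log L) * (2 * ∑ e ∈ insert (0 : Site 2) unitSteps, |dWaveFormFactor e / Real.sqrt 2|) ^ 4 ≤ c / 4 → ∀ (p : Finset (Orb (FermionTorus 2 L)) → Prop), c * (L : ℝ) ^ 4 ≤ (Matrix.gibbsState (κ * Real.log L) ((hubbardTorus 2 L 1 U).toBlock p p) (((pairField dWaveFormFactor L)ᴴ * pairField dWaveFormFactor L).toBlock p p)).re → c / 2 * (L : ℝ) ^ 4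 ≤ (Matrix.gibbsState (κ * Real.log L) ((hubbardTorus 2 L 1 U + (ε : ℂ) • (((1 : ℂ) / (L : ℂ) ^ 4) • ((pairField dWaveFormFactor L)ᴴ * pairField dWaveFormFactor L))).toBlock p p) (((pairField dWaveFormFactor L)ᴴ * pairField dWaveFormFactor L).toBlock p p)).re := by
  intro L _ U κ ε c hκ hε hεs p h
  have hL1 : (1 : ℝ) ≤ (L : ℝ) := by exact_mod_cast NeZero.one_le
  have hlog : 0 ≤ Real.log L := Real.log_nonneg hL1
  have hβ : 0 ≤ κ * Real.log L := mul_nonneg hκ hlog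
  have key := re_gibbsState_toBlock_penalised_ge L U (κ * Real.log L) ε hβ hε p
  have hL4 : (0 : ℝ) ≤ (L : ℝ) ^ 4 := by positivity
  have herr : 2 * (κ * Real.log L) * ε *
      (2 * ∑ e ∈ insert (0 : Site 2) unitSteps, |dWaveFormFactor e / Real.sqrt 2|) ^ 4 * (L : ℝ) ^ 4 ≤
      c / 2 * (L : ℝ) ^ 4 := by
    have := mul_le_mul_of_nonneg_right hεs hL4
    nlinarith [this]
  linarith

end Summit.HubbardSuperconductivity.HubbardSuperconductivity.Theorems

end
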